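import Summits.QuantumFields.BalabanUV.Beta.EriceFlowEnclosureB12AsPrintedHistoryContagionShiftFlowZeroTwoLoop

/-!
# Beta / EriceFlowEnclosureB12AsPrintedHistoryContagionShiftFlowZeroTwoLoopWitness — ASYMPTOTIC FREEDOM IS CONTAGIOUS, part 42: THE TWO-LOOP LETTER WITH MEMORY IS STRICTLY
# WIDER THAN THE MARKOV TWO-LOOP LETTER (kernel witness for part 39).  The lag-one functional **`B₂ u = 2 + u(1)²`** on ]0, ¼]^ℕ — its g²-coefficient sits ONE SCALE UP the
# history — (i) has the memory profile `(1, ½)`, the value β₀ = 2 at the zero history in part 32's sense, the floor 2 and node U2's contraction regime, so node U2's `solution B₂ ¼`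
# is an asymptotically free box solution (`16 + 2m ≤ 1∕h(m)²`); (ii) SATISFIES part 39's two-loop letter with memory (T2m) with `b₁ = 1`, `C₂ = 2` (`twoLoopMemory_B₂`:
# `|B₂ u − 2 − u(0)²| = |u(1)² − u(0)²|` is the age-1 term of the (T2m) weight), whence by part 39 EVERY AF box solution of its flow — in particular node U2's — has an ABSOLUTE
# two-loop Λ: `1∕h(m)² − 2m − ½·log m → Λ` (`twoLoopLambda_B₂`); and (iii) does NOT satisfy d4-p2's Markov two-loop letter with ANY summable profile: for EVERY pair (b₀′, b₁′) and
# EVERY ρ with `|B₂ u − (b₀′ + b₁′u(0)²)| ≤ ρ(a)` on the sub-boxes ]0, a]^ℕ (a ≤ ¼) one has **`ρ(a) ≥ 3a²∕8`** (`markovLetter_profile_ge`: compare the histories (a, a, a, …) and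
# (a, a∕2, a∕2, …), same age-0 coupling, B₂ differing by 3a²∕4) and therefore **`Σ_l ρ(c_{l+1}) = ∞`** along every envelope `c_i = (1∕p² + i·b)^{−1∕2}` (`not_summable_markovLetter`,
# harmonic comparison) — so (E54a) `exists_tendsto_twoLoopLambda`'s hypothesis pair (`htwo`, `hsum`) is UNINHABITED for B₂, while #68h's `exists_twoLoopLambda` applies:
# the with-memory letter is STRICTLY wider on flows with genuine two-loop memory (headline `twoLoopMemory_strictly_wider`).
# (β-flow team, prover 1, unit `b2b-balaban-beta-bflow-p1`, gen 39; ROW AP-I·Uc × ROW D4-AUTONOMY — witness)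

HONEST FRAMING (page 1 of everything the β sub-cell writes): discharging `BetaPertH` makes Bałaban's UV stability UNCONDITIONAL — a
real constructive-QFT result; it is NOT the continuum limit and NOT the Clay problem.  HONEST DEPENDENCY (cell reorg 2026-08-19,
verbatim): «continuum YM on T⁴ ⇐ BetaPertH ∧ nine spine estimates (0/9 proved); BetaPertH ⇐ (D1) ∧ (D4) ∧ CAP+tail; G-an2-4 gates
asym, D1 and NE2/3/4.»  THIS MODULE DISCHARGES NOTHING: one explicit toy functional, written inline (NOT Bałaban's β — whether ITS limit functional carries genuine two-loop memory
is NOT PRINTED, [I] p. 298); node U2's `solution ∕ solution_seqBox ∕ memFlow_solution ∕ invSq_eq_of_memFlow ∕ mul_lower_le_drive ∕ Probes.summable_weighted ∕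
one_div_sqrt_one_div_sq`, `T4BetaStationary.summable_profile`, part 39's `exists_twoLoopLambda`, Mathlib's `Real.not_summable_natCast_inv` BY NAME — nothing restated; d4-p2's
(E54a) is NOT imported (its hypothesis SHAPE is written out verbatim and shown uninhabited for B₂).  [I] = T. Bałaban, Commun. Math. Phys. **109** (1987) 249–301 [Balaban1987RG1].

WHAT THIS FILE PROVES (0 sorry, 0 def): `memoryProfile_B₂`, `valueAtZero_B₂`, `two_le_B₂`, `B₂_solution`, `B₂_profile`, **`twoLoopMemory_B₂`**, **`twoLoopLambda_B₂`**,
**`markovLetter_profile_ge`**, **`not_summable_markovLetter`**, HEADLINE **`twoLoopMemory_strictly_wider`**.  NOT CLAIMED: anything about Bałaban's β; `BetaPertH`; continuum; Clay.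
-/

namespace Summit.QuantumFields.BalabanUV.Beta.EriceFlowEnclosureB12AsPrintedHistoryContagionShiftFlowZeroTwoLoopWitness

open Finset Filter Topology
open Literature.MathematicalPhysics.QuantumFieldTheory.Balaban1983to89
open Literature.MathematicalPhysics.QuantumFieldTheory.Balaban1983to89.T4BetaStationary (SeqBox MemoryProfile summable_profile)
open Literature.MathematicalPhysics.QuantumFieldTheory.Balaban1983to89.T4BetaStationary.Probes (summable_weighted)
open Literature.MathematicalPhysics.QuantumFieldTheory.Balaban1983to89.T4BetaFlowWellPosed (MemFlow solution seqBox_shift solution_seqBox memFlow_solution invSq_eq_of_memFlow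
  mul_lower_le_drive one_div_sqrt_one_div_sq)
open Summit.QuantumFields.BalabanUV.Beta.EriceFlowEnclosureB12AsPrintedHistoryContagionShiftFlowZeroTwoLoop (exists_twoLoopLambda)

noncomputable section

/-! ## The lag-one two-loop functional `B₂ u = 2 + u(1)²` on ]0, ¼]^ℕ -/

/-- `B₂` has the memory profile `(1, ½)` on ]0, ¼]^ℕ: `|u(1)² − u′(1)²| ≤ ½|u(1) − u′(1)|` is the age-1 term of the profile. [folklore] -/
theorem memoryProfile_B₂ : MemoryProfile 1 (1 / 2) (1 / 4) (fun u : ℕ → ℝ => 2 + u 1 ^ 2) := by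
  intro u u' hu hu'
  have hs := summable_profile (θ := 1 / 2) (by norm_num) (by norm_num) hu hu'
  have h1 : (1 / 2 : ℝ) ^ 1 * |u 1 - u' 1| ≤ ∑' j, (1 / 2 : ℝ) ^ j * |u j - u' j| :=
    hs.le_tsum 1 (fun j _ => mul_nonneg (pow_nonneg (by norm_num) j) (abs_nonneg _))
  rw [pow_one] at h1
  have e : (2 + u 1 ^ 2) - (2 + u' 1 ^ 2) = (u 1 - u' 1) * (u 1 + u' 1) := by ring
  rw [e, abs_mul, one_mul]
  have hsum : |u 1 + u' 1| ≤ 1 / 2 := by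
    rw [abs_of_pos (by linarith [(hu 1).1, (hu' 1).1])]; linarith [(hu 1).2, (hu' 1).2]
  calc |u 1 - u' 1| * |u 1 + u' 1| ≤ |u 1 - u' 1| * (1 / 2) := mul_le_mul_of_nonneg_left hsum (abs_nonneg _)
    _ = 1 / 2 * |u 1 - u' 1| := by ring
    _ ≤ _ := h1

/-- The value of `B₂` at the zero history is β₀ = 2, in part 32's exact sense with `(C_m, θ) = (1, ½)`: `|B₂ u − 2| = u(1)² ≤ ½u(1)`. [folklore] -/
theorem valueAtZero_B₂ : ∀ u : ℕ → ℝ, SeqBox (1 / 4) u → |(2 + u 1 ^ 2) - 2| ≤ 1 * ∑' j, (1 / 2 : ℝ) ^ j * u j := by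
  intro u hu
  have hs := summable_weighted (θ := 1 / 2) (by norm_num) (by norm_num) hu
  have h1 : (1 / 2 : ℝ) ^ 1 * u 1 ≤ ∑' j, (1 / 2 : ℝ) ^ j * u j :=
    hs.le_tsum 1 (fun j _ => mul_nonneg (pow_nonneg (by norm_num) j) (hu j).1.le)
  rw [pow_one] at h1
  rw [show (2 : ℝ) + u 1 ^ 2 - 2 = u 1 ^ 2 by ring, abs_of_pos (pow_pos (hu 1).1 2), one_mul]
  nlinarith [(hu 1).1, (hu 1).2]

/-- The floor: `2 ≤ B₂ u`. [folklore] -/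
theorem two_le_B₂ : ∀ u : ℕ → ℝ, SeqBox (1 / 4) u → (2 : ℝ) ≤ 2 + u 1 ^ 2 := fun u _ => by nlinarith

/-- Node U2's solution from the pin ¼ is a box solution in ]0, ¼] (floor 2, contraction `1·¼ < 2·(1 − ½)`). [folklore] -/
theorem B₂_solution : SeqBox (1 / 4) (solution (fun u : ℕ → ℝ => 2 + u 1 ^ 2) (1 / 4)) ∧
    MemFlow (fun u : ℕ → ℝ => 2 + u 1 ^ 2) (1 / 4) (solution (fun u : ℕ → ℝ => 2 + u 1 ^ 2) (1 / 4)) :=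
  ⟨solution_seqBox memoryProfile_B₂ (by norm_num) (by norm_num) (by norm_num) (by norm_num) le_rfl two_pos two_le_B₂ (by norm_num),
    memFlow_solution memoryProfile_B₂ (by norm_num) (by norm_num) (by norm_num) (by norm_num) le_rfl two_pos two_le_B₂ (by norm_num)⟩

/-- The solution is an AF reference: `1∕(¼)² + 2·m ≤ 1∕h(m)²`. [folklore] -/
theorem B₂_profile : ∀ m : ℕ, 1 / (1 / 4 : ℝ) ^ 2 + 2 * (m : ℝ) ≤ 1 / (solution (fun u : ℕ → ℝ => 2 + u 1 ^ 2) (1 / 4) m) ^ 2 := by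
  intro m
  obtain ⟨hs, hf⟩ := B₂_solution
  rw [invSq_eq_of_memFlow hf m]
  have := mul_lower_le_drive (b := 2) two_le_B₂ hs m
  linarith

/-- **`B₂` SATISFIES THE TWO-LOOP LETTER WITH MEMORY (T2m)** with β₀ = 2, b₁ = 1, C₂ = 2 (θ = ½): `|B₂ u − 2 − 1·u(0)²| = |u(1)² − u(0)²| ≤ 2·Σ_j (½)^j (u(j)⁴ + |u(j)² − u(0)²|)`
(the age-1 term of the weight). [folklore] -/
theorem twoLoopMemory_B₂ : ∀ u : ℕ → ℝ, SeqBox (1 / 4) u →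
    |(2 + u 1 ^ 2) - 2 - 1 * u 0 ^ 2| ≤ 2 * ∑' j, (1 / 2 : ℝ) ^ j * (u j ^ 4 + |u j ^ 2 - u 0 ^ 2|) := by
  intro u hu
  have hs : Summable fun j : ℕ => (1 / 2 : ℝ) ^ j * (u j ^ 4 + |u j ^ 2 - u 0 ^ 2|) := by
    have hg : Summable fun j : ℕ => (1 / 2 : ℝ) ^ j * (((1 : ℝ) / 4) ^ 4 + 2 * (1 / 4) ^ 2) :=
      (summable_geometric_of_lt_one (by norm_num) (by norm_num)).mul_right _
    refine Summable.of_nonneg_of_le (fun j => by positivity) (fun j => mul_le_mul_of_nonneg_left ?_ (by positivity)) hg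
    have h4 : u j ^ 4 ≤ (1 / 4 : ℝ) ^ 4 := pow_le_pow_left₀ (hu j).1.le (hu j).2 4
    have ha : |u j ^ 2 - u 0 ^ 2| ≤ 2 * (1 / 4) ^ 2 := by
      rw [abs_le]
      have h1 : u j ^ 2 ≤ (1 / 4 : ℝ) ^ 2 := pow_le_pow_left₀ (hu j).1.le (hu j).2 2
      have h2 : u 0 ^ 2 ≤ (1 / 4 : ℝ) ^ 2 := pow_le_pow_left₀ (hu 0).1.le (hu 0).2 2
      constructor <;> nlinarith [pow_pos (hu j).1 2, pow_pos (hu 0).1 2]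
    linarith
  have h1 : (1 / 2 : ℝ) ^ 1 * (u 1 ^ 4 + |u 1 ^ 2 - u 0 ^ 2|) ≤ ∑' j, (1 / 2 : ℝ) ^ j * (u j ^ 4 + |u j ^ 2 - u 0 ^ 2|) :=
    hs.le_tsum 1 (fun j _ => by positivity)
  rw [pow_one] at h1
  rw [show (2 : ℝ) + u 1 ^ 2 - 2 - 1 * u 0 ^ 2 = u 1 ^ 2 - u 0 ^ 2 by ring]
  nlinarith [abs_nonneg (u 1 ^ 2 - u 0 ^ 2), pow_nonneg (hu 1).1.le 4]

/-- **EVERY AF BOX SOLUTION OF `B₂`'s FLOW HAS AN ABSOLUTE TWO-LOOP Λ** (part 39 `exists_twoLoopLambda` BY NAME with β₀ = 2, b₁ = 1): for every box solution t of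
`MemFlow B₂ g* t` with an AF profile, `1∕t(m)² − 2m − ½·log m → Λ(t)`; in particular for node U2's `solution B₂ ¼`. [folklore] -/
theorem twoLoopLambda_B₂ {t : ℕ → ℝ} {gs ta bs : ℝ} (hbs : 0 < bs) (hta : 0 < ta) (hts : SeqBox (1 / 4) t)
    (htf : MemFlow (fun u : ℕ → ℝ => 2 + u 1 ^ 2) gs t) (hprof : ∀ m : ℕ, 1 / ta ^ 2 + bs * (m : ℝ) ≤ 1 / (t m) ^ 2) :
    ∃ Λ : ℝ, Tendsto (fun m : ℕ => 1 / t m ^ 2 - (m : ℝ) * 2 - 1 / 2 * Real.log (m : ℝ)) atTop (𝓝 Λ) :=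
  exists_twoLoopLambda (γ := 1 / 4) (b₁ := 1) (by norm_num) (by norm_num) (by norm_num) (by norm_num) hbs hta valueAtZero_B₂ twoLoopMemory_B₂ hts htf hprof

/-- **NO MARKOV TWO-LOOP LETTER FOR `B₂` HAS A SMALL PROFILE**: if `|B₂ u − (b₀′ + b₁′u(0)²)| ≤ ρ(a)` for all ]0, a]-valued histories (every a ≤ ¼), then **`3a²∕8 ≤ ρ(a)`** —
the histories (a, a, a, …) and (a, a∕2, a∕2, …) have the same age-0 coupling and B₂-values differing by 3a²∕4. [folklore] -/
theorem markovLetter_profile_ge {b₀' b₁' : ℝ} {ρ : ℝ → ℝ}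
    (htwo : ∀ a : ℝ, 0 < a → a ≤ 1 / 4 → ∀ u : ℕ → ℝ, SeqBox a u → |(2 + u 1 ^ 2) - (b₀' + b₁' * u 0 ^ 2)| ≤ ρ a)
    {a : ℝ} (ha : 0 < a) (ha' : a ≤ 1 / 4) : 3 * a ^ 2 / 8 ≤ ρ a := by
  set u' : ℕ → ℝ := fun j => a / 2 + a / 2 * (0 : ℝ) ^ j with hu'
  have hu'0 : u' 0 = a := by simp only [hu', pow_zero]; ring
  have hu'1 : u' 1 = a / 2 := by simp only [hu', pow_one]; ring
  have hbox' : SeqBox a u' := fun j => by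
    rcases Nat.eq_zero_or_pos j with rfl | hj
    · rw [hu'0]; exact ⟨ha, le_rfl⟩
    · have : u' j = a / 2 := by simp only [hu', zero_pow (Nat.pos_iff_ne_zero.mp hj)]; ring
      rw [this]; exact ⟨by positivity, by linarith⟩
  have h1 := htwo a ha ha' (fun _ => a) (fun _ => ⟨ha, le_rfl⟩)
  have h2 := htwo a ha ha' u' hbox'
  rw [hu'0, hu'1] at h2
  have e : (2 + a ^ 2 - (b₀' + b₁' * a ^ 2)) - (2 + (a / 2) ^ 2 - (b₀' + b₁' * a ^ 2)) = 3 * a ^ 2 / 4 := by ring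
  have h3 : |3 * a ^ 2 / 4| ≤ ρ a + ρ a := by
    rw [← e]; exact (abs_sub _ _).trans (add_le_add h1 h2)
  rw [abs_of_pos (by positivity)] at h3
  linarith

/-- **THE PROFILE IS NOT SUMMABLE ALONG ANY ENVELOPE**: under the Markov two-loop letter for `B₂` (ANY b₀′, b₁′, ρ) and ANY pin `p ∈ ]0, ¼]`, rate `b > 0`:
`Σ_l ρ((1∕p² + (l+1)·b)^{−1∕2}) = ∞` — `ρ(c) ≥ 3c²∕8 ≥ (3∕8)∕((l+1)(1∕p² + b))`, a harmonic minorant.  So d4-p2's (E54a) `exists_tendsto_twoLoopLambda` has NO instance for B₂.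
[folklore] -/
theorem not_summable_markovLetter {b₀' b₁' p b : ℝ} {ρ : ℝ → ℝ}
    (htwo : ∀ a : ℝ, 0 < a → a ≤ 1 / 4 → ∀ u : ℕ → ℝ, SeqBox a u → |(2 + u 1 ^ 2) - (b₀' + b₁' * u 0 ^ 2)| ≤ ρ a)
    (hp : 0 < p) (hp' : p ≤ 1 / 4) (hb : 0 < b) :
    ¬ Summable fun l : ℕ => ρ (1 / Real.sqrt (1 / p ^ 2 + ((l : ℝ) + 1) * b)) := by
  intro hsum
  -- the envelope points are pins of ]0, p] ⊆ ]0, ¼]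
  have hc : ∀ l : ℕ, 0 < 1 / Real.sqrt (1 / p ^ 2 + ((l : ℝ) + 1) * b) ∧ 1 / Real.sqrt (1 / p ^ 2 + ((l : ℝ) + 1) * b) ≤ 1 / 4 := by
    intro l
    have hx : 0 < 1 / p ^ 2 + ((l : ℝ) + 1) * b := by positivity
    refine ⟨one_div_pos.mpr (Real.sqrt_pos.mpr hx), ?_⟩
    calc 1 / Real.sqrt (1 / p ^ 2 + ((l : ℝ) + 1) * b) ≤ 1 / Real.sqrt (1 / p ^ 2) :=
          one_div_le_one_div_of_le (Real.sqrt_pos.mpr (by positivity)) (Real.sqrt_le_sqrt (by nlinarith [hb.le]))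
      _ = p := one_div_sqrt_one_div_sq hp
      _ ≤ 1 / 4 := hp'
  -- the harmonic minorant
  have hK : 0 < 3 / 8 / (1 / p ^ 2 + b) := by positivity
  have hminor : ∀ l : ℕ, 3 / 8 / (1 / p ^ 2 + b) * (1 / ((l : ℝ) + 1)) ≤ ρ (1 / Real.sqrt (1 / p ^ 2 + ((l : ℝ) + 1) * b)) := by
    intro l
    obtain ⟨hc0, hc4⟩ := hc l
    have hx : 0 < 1 / p ^ 2 + ((l : ℝ) + 1) * b := by positivity
    have h1 := markovLetter_profile_ge htwo hc0 hc4
    have hsq : (1 / Real.sqrt (1 / p ^ 2 + ((l : ℝ) + 1) * b)) ^ 2 = 1 / (1 / p ^ 2 + ((l : ℝ) + 1) * b) := by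
      rw [div_pow, one_pow, Real.sq_sqrt hx.le]
    rw [hsq] at h1
    have hl1 : (1 : ℝ) ≤ (l : ℝ) + 1 := by linarith [(Nat.cast_nonneg l : (0 : ℝ) ≤ l)]
    have hden : 1 / p ^ 2 + ((l : ℝ) + 1) * b ≤ ((l : ℝ) + 1) * (1 / p ^ 2 + b) := by
      have : 0 ≤ 1 / p ^ 2 := by positivity
      nlinarith
    have h2 : 1 / (((l : ℝ) + 1) * (1 / p ^ 2 + b)) ≤ 1 / (1 / p ^ 2 + ((l : ℝ) + 1) * b) := one_div_le_one_div_of_le hx hden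
    calc 3 / 8 / (1 / p ^ 2 + b) * (1 / ((l : ℝ) + 1)) = 3 * (1 / (((l : ℝ) + 1) * (1 / p ^ 2 + b))) / 8 := by
          field_simp
      _ ≤ 3 * (1 / (1 / p ^ 2 + ((l : ℝ) + 1) * b)) / 8 := by gcongr
      _ ≤ _ := by linarith
  have hharm : Summable fun l : ℕ => 3 / 8 / (1 / p ^ 2 + b) * (1 / ((l : ℝ) + 1)) :=
    Summable.of_nonneg_of_le (fun l => by positivity) hminor hsum
  have hharm' : Summable fun l : ℕ => 1 / ((l : ℝ) + 1) := by
    have := hharm.mul_left (1 / (3 / 8 / (1 / p ^ 2 + b)))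
    refine this.congr fun l => ?_
    field_simp
  have hnat : Summable fun l : ℕ => ((l : ℝ))⁻¹ := by
    rw [← summable_nat_add_iff 1]
    refine hharm'.congr fun l => ?_
    push_cast; rw [one_div]
  exact Real.not_summable_natCast_inv hnat

/-- **HEADLINE — THE TWO-LOOP LETTER WITH MEMORY IS STRICTLY WIDER THAN THE MARKOV TWO-LOOP LETTER.**  There is a functional on a box (B₂ on ]0, ¼]) with a memory profile, a value
at the zero history, node U2's floored regime, an asymptotically free box solution, and part 39's two-loop letter with memory (T2m) — so that EVERY AF box solution of its flow has
an absolute two-loop Λ by part 39 — for which the Markov two-loop letter `|B u − (b₀′ + b₁′u(0)²)| ≤ ρ(a)` with a profile summable along an envelope (the hypothesis pair of d4-p2's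
(E54a)) is UNINHABITED for every choice of (b₀′, b₁′, ρ) and every envelope. [folklore] -/
theorem twoLoopMemory_strictly_wider :
    ∃ (B : (ℕ → ℝ) → ℝ) (γ β₀ b₁ C₂ : ℝ) (t : ℕ → ℝ),
      MemoryProfile 1 (1 / 2) γ B ∧ SeqBox γ t ∧ MemFlow B γ t ∧ (∀ m : ℕ, 1 / γ ^ 2 + 2 * (m : ℝ) ≤ 1 / (t m) ^ 2) ∧
      (∀ u : ℕ → ℝ, SeqBox γ u → |B u - β₀ - b₁ * u 0 ^ 2| ≤ C₂ * ∑' j, (1 / 2 : ℝ) ^ j * (u j ^ 4 + |u j ^ 2 - u 0 ^ 2|)) ∧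
      (∃ Λ : ℝ, Tendsto (fun m : ℕ => 1 / t m ^ 2 - (m : ℝ) * β₀ - b₁ / β₀ * Real.log (m : ℝ)) atTop (𝓝 Λ)) ∧
      ∀ (b₀' b₁' p b : ℝ) (ρ : ℝ → ℝ), 0 < p → p ≤ γ → 0 < b →
        (∀ a : ℝ, 0 < a → a ≤ γ → ∀ u : ℕ → ℝ, SeqBox a u → |B u - (b₀' + b₁' * u 0 ^ 2)| ≤ ρ a) →
        ¬ Summable fun l : ℕ => ρ (1 / Real.sqrt (1 / p ^ 2 + ((l : ℝ) + 1) * b)) := by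
  obtain ⟨hs, hf⟩ := B₂_solution
  obtain ⟨Λ, hΛ⟩ := twoLoopLambda_B₂ two_pos (by norm_num : (0 : ℝ) < 1 / 4) hs hf B₂_profile
  refine ⟨fun u => 2 + u 1 ^ 2, 1 / 4, 2, 1, 2, solution (fun u : ℕ → ℝ => 2 + u 1 ^ 2) (1 / 4), memoryProfile_B₂, hs, hf, B₂_profile,
    twoLoopMemory_B₂, ⟨Λ, hΛ.congr fun m => by ring⟩, fun b₀' b₁' p b ρ hp hp' hb htwo => not_summable_markovLetter htwo hp hp' hb⟩

end

end Summit.QuantumFields.BalabanUV.Beta.EriceFlowEnclosureB12AsPrintedHistoryContagionShiftFlowZeroTwoLoopWitness
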